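import Summits.HubbardSuperconductivity.HubbardSuperconductivity.Theorems.SgAnchorOrder.Negative.BlockForms
import Literature.MathematicalPhysics.QuantumLattice.SpinGaugedHubbardTorus
import Literature.MathematicalPhysics.QuantumLattice.HubbardGaugeBound

/-!
# `SgAnchorOrder` (route `ColourTheSpin`, stmt-HubbardSuperconductivity-16273) — negative lane, file 2/3:
# the fibred pair field, flux orthogonality, the one-link Dirichlet identity

For the `Q₈`-spin-gauged torus of `SpinGaugedHubbardTorus.lean`: the transported `B₁g` pair field is
fibred over link configurations, `(Δ_d^g ψ)(·,k) = Σ_b P_b^{(k_b)} ψ(·,k)` with `‖P_b^{(u)}‖ ≤ 4` and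
`Σ_{u∈Q₈} P_b^{(u)} = 0` (from `Q8.sum_rep`), whence the cross terms `b ≠ b'` vanish on link-averaged
vectors and `‖Δ_d^g ψ‖² ≤ (16|Bond L| + 48θ|Bond L|²)‖ψ‖²` when every link of `ψ` is `θ`-close to its
average (`pair_bound`); and `Re⟨ψ,(1 ⊗ E_b)ψ⟩ = ‖ψ - Q_bψ‖²` (`dirichlet`). Support lemmas for
`ColourTheSpinSgAnchorOrder_refuted`; nothing here asserts a route statement.
-/

noncomputable section

set_option linter.dupNamespace false

namespace Summit.HubbardSuperconductivity.HubbardSuperconductivity.Theorems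

namespace ColourTheSpinSgAnchorOrderRefutation

open scoped BigOperators Matrix ComplexConjugate ComplexOrder
open Literature.MathematicalPhysics.QuantumLattice

/-! ### Part C — the model: fibred pair field, its norm, flux orthogonality -/

section Model

open SpinGauged GaugedHubbard
open scoped Matrix.Norms.L2Operator Kronecker

variable (L : ℕ)

set_option quotPrecheck false in
local notation "𝒮" => Finset (Orb (FermionTorus 2 L))

/- The link averaging `Q_b ψ` (as an explicit function; no definition is introduced). -/
set_option quotPrecheck false in
local notation:max "𝔸vg " b:max ψ:max =>
  (fun ik : Finset (Orb (FermionTorus 2 L)) × (GaugedHubbard.Bond L → Q8) =>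
    (1 / (Fintype.card Q8 : ℂ)) * ∑ u : Q8, ψ (ik.1, Function.update ik.2 b u))

/-- The action of the one-link electric operator: `(E_b f)(k) = f(k) - |Q₈|⁻¹ Σ_u f(k[b ↦ u])`. -/
theorem electricLink_mulVec (b : Bond L) (f : (Bond L → Q8) → ℂ) (k : Bond L → Q8) :
    (SpinGauged.electricLink (G := Q8) L b *ᵥ f) k =
      f k - (1 / (Fintype.card Q8 : ℂ)) * ∑ u, f (Function.update k b u) := by
  simp only [Matrix.mulVec, dotProduct, SpinGauged.electricLink_apply, ite_mul, zero_mul]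
  rw [sum_ite_eq_update b k (fun k' => ((if k b = k' b then (1 : ℂ) else 0) -
    1 / (Fintype.card Q8 : ℂ)) * f k')]
  simp only [Function.update_self, sub_mul, Finset.sum_sub_distrib, ite_mul, one_mul, zero_mul]
  rw [Finset.sum_ite_eq, ← Finset.mul_sum]
  simp only [Finset.mem_univ, if_true, Function.update_eq_self]

/-- `(1 ⊗ E_b) ψ = ψ - Q_b ψ`. [folklore] -/
theorem oneKronElectricLink_mulVec (b : Bond L) (ψ : Index L Q8 → ℂ) :
    ((1 : Matrix 𝒮 𝒮 ℂ) ⊗ₖ SpinGauged.electricLink (G := Q8) L b) *ᵥ ψ = ψ - 𝔸vg b ψ := by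
  funext ik
  obtain ⟨s, k⟩ := ik
  rw [one_kron_mulVec, electricLink_mulVec, Pi.sub_apply]

/-- **Dirichlet identity**: `Re ⟨ψ, (1 ⊗ E_b) ψ⟩ = ‖ψ - Q_b ψ‖²`. -/
theorem dirichlet (b : Bond L) (ψ : Index L Q8 → ℂ) :
    (star ψ ⬝ᵥ ((1 : Matrix 𝒮 𝒮 ℂ) ⊗ₖ SpinGauged.electricLink (G := Q8) L b) *ᵥ ψ).re
      = eucNorm (ψ - 𝔸vg b ψ) ^ 2 := by
  rw [oneKronElectricLink_mulVec, eucNorm_sq, star_sub, sub_dotProduct, dotProduct_sub, dotProduct_sub,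
    star_dotProduct_avg b ψ (𝔸vg b ψ) (fun _ _ => rfl),
    star_avg_dotProduct b ψ (𝔸vg b ψ) (fun _ _ => rfl)]
  simp only [Complex.sub_re]
  ring

variable [NeZero L]

/- The fibre pair operator `P_b^{(u)} = g_d(b) Σ_{στ} (ερ(u))_{στ} c_{xσ} c_{x+eᵢ,τ}` on Fock space
(local notation; no definition is introduced). -/
set_option quotPrecheck false in
local notation:max "ℙop " b:max u:max =>
  ((if Prod.snd b = (0 : Fin 2) then (1 : ℂ) else -1) •
    ∑ σ : Fin 2, ∑ τ : Fin 2, SpinGauged.epsRep Q8.rep u σ τ •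
      (annihilation (orb (Prod.fst b) σ) *
        annihilation (orb (FermionTorus.shift (Prod.fst b) (Prod.snd b)) τ) :
          Matrix (Finset (Orb (FermionTorus 2 L))) (Finset (Orb (FermionTorus 2 L))) ℂ))

/- The fibre vectors `w_b(k) = P_b^{(k_b)} ψ(·,k)` (local notation). -/
set_option quotPrecheck false in
local notation:max "𝕎v " ψ:max b:max k:max => (ℙop b (k b) *ᵥ fun s => ψ (s, k))

/- The fibre vectors `z_{b,b'}(k) = P_{b'}^{(k_{b'})} (Q_bψ)(·,k)` (local notation). -/
set_option quotPrecheck false in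
local notation:max "ℤv " ψ:max b:max b':max k:max => (ℙop b' (k b') *ᵥ fun s => (𝔸vg b ψ) (s, k))

/-- **The pair field is fibred over link configurations**:
`(Δ_d^g ψ)(·, k) = (Σ_b P_b^{(k_b)}) ψ(·, k)`. -/
theorem pairField_mulVec (ψ : Index L Q8 → ℂ) (s : 𝒮) (k : Bond L → Q8) :
    (spinGaugedPairField L *ᵥ ψ) (s, k) = ((∑ b, ℙop b (k b)) *ᵥ fun s' => ψ (s', k)) s := by
  simp only [spinGaugedPairField, spinGaugedPairFieldWith, Matrix.sum_mulVec,
    Matrix.smul_mulVec, Finset.sum_apply, Pi.smul_apply, smul_eq_mul, kron_diagonal_mulVec]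

/-- `|(ε ρ(u))_{στ}| ≤ 1` (`ρ(u)` is unitary). [folklore] -/
theorem norm_epsRep_le_one (u : Q8) (σ τ : Fin 2) : ‖epsRep Q8.rep u σ τ‖ ≤ 1 := by
  unfold SpinGauged.epsRep
  split_ifs
  · exact entry_norm_bound_of_unitary (Q8.rep_mem_unitaryGroup u) _ _
  · rw [norm_neg]
    exact entry_norm_bound_of_unitary (Q8.rep_mem_unitaryGroup u) _ _

/-- `Σ_{u ∈ Q₈} (ερ(u))_{στ} = 0` (from `Σ_u ρ(u) = 0`). -/
theorem sum_epsRep (σ τ : Fin 2) : ∑ u : Q8, epsRep Q8.rep u σ τ = 0 := by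
  have h : ∀ i j : Fin 2, ∑ u : Q8, Q8.rep u i j = 0 := fun i j => by
    have := congrArg (fun M : Matrix (Fin 2) (Fin 2) ℂ => M i j) Q8.sum_rep
    simpa [Matrix.sum_apply] using this
  unfold SpinGauged.epsRep
  split_ifs
  · exact h 1 τ
  · rw [Finset.sum_neg_distrib, h 0 τ, neg_zero]

/-- **Flux orthogonality at the operator level**: `Σ_{u ∈ Q₈} P_b^{(u)} = 0`. -/
theorem sum_pairOp (b : Bond L) : ∑ u : Q8, ℙop b u = 0 := by
  rw [← Finset.smul_sum]
  have : ∑ u : Q8, ∑ σ : Fin 2, ∑ τ : Fin 2, epsRep Q8.rep u σ τ •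
      (annihilation (orb b.1 σ) * annihilation (orb (b.1.shift b.2) τ) : Matrix 𝒮 𝒮 ℂ) = 0 := by
    rw [Finset.sum_comm]
    refine Finset.sum_eq_zero fun σ _ => ?_
    rw [Finset.sum_comm]
    refine Finset.sum_eq_zero fun τ _ => ?_
    rw [← Finset.sum_smul, sum_epsRep, zero_smul]
  rw [this, smul_zero]

/-- `‖P_b^{(u)}‖ ≤ 4` in operator norm (`‖c‖ ≤ 1`, `|ερ| ≤ 1`, four spin pairs). -/
theorem norm_pairOp_le (b : Bond L) (u : Q8) : ‖ℙop b u‖ ≤ 4 := by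
  have hc : ‖(if b.2 = 0 then (1 : ℂ) else -1)‖ ≤ 1 := by split_ifs <;> simp
  have hterm : ∀ σ τ : Fin 2, ‖epsRep Q8.rep u σ τ •
      (annihilation (orb b.1 σ) * annihilation (orb (b.1.shift b.2) τ) : Matrix 𝒮 𝒮 ℂ)‖ ≤ 1 := by
    intro σ τ
    refine (norm_smul_le _ _).trans ?_
    have h1 := norm_annihilation_le_one (ι := Orb (FermionTorus 2 L)) (orb b.1 σ)
    have h2 := norm_annihilation_le_one (ι := Orb (FermionTorus 2 L)) (orb (b.1.shift b.2) τ)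
    have h3 := norm_mul_le (annihilation (orb b.1 σ) : Matrix 𝒮 𝒮 ℂ)
      (annihilation (orb (b.1.shift b.2) τ))
    have h4 := norm_epsRep_le_one u σ τ
    have h5 := norm_nonneg (annihilation (orb b.1 σ) : Matrix 𝒮 𝒮 ℂ)
    have h6 := norm_nonneg (annihilation (orb (b.1.shift b.2) τ) : Matrix 𝒮 𝒮 ℂ)
    have h7 := norm_nonneg (epsRep Q8.rep u σ τ)
    have h8 : ‖(annihilation (orb b.1 σ) : Matrix 𝒮 𝒮 ℂ)‖ *
        ‖(annihilation (orb (b.1.shift b.2) τ) : Matrix 𝒮 𝒮 ℂ)‖ ≤ 1 := by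
      have := mul_le_mul h1 h2 h6 zero_le_one
      rwa [one_mul] at this
    nlinarith [norm_nonneg ((annihilation (orb b.1 σ) : Matrix 𝒮 𝒮 ℂ) *
      annihilation (orb (b.1.shift b.2) τ))]
  refine (norm_smul_le _ _).trans ?_
  have hsum : ‖∑ σ : Fin 2, ∑ τ : Fin 2, epsRep Q8.rep u σ τ •
      (annihilation (orb b.1 σ) * annihilation (orb (b.1.shift b.2) τ) : Matrix 𝒮 𝒮 ℂ)‖ ≤ 4 := by
    calc _ ≤ ∑ σ : Fin 2, ‖∑ τ : Fin 2, epsRep Q8.rep u σ τ •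
          (annihilation (orb b.1 σ) * annihilation (orb (b.1.shift b.2) τ) : Matrix 𝒮 𝒮 ℂ)‖ :=
          norm_sum_le _ _
      _ ≤ ∑ σ : Fin 2, ∑ τ : Fin 2, (1 : ℝ) := Finset.sum_le_sum fun σ _ =>
          (norm_sum_le _ _).trans (Finset.sum_le_sum fun τ _ => hterm σ τ)
      _ = 4 := by norm_num
  have h0 := norm_nonneg (∑ σ : Fin 2, ∑ τ : Fin 2, epsRep Q8.rep u σ τ •
      (annihilation (orb b.1 σ) * annihilation (orb (b.1.shift b.2) τ) : Matrix 𝒮 𝒮 ℂ))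
  nlinarith

/-- `‖P_b^{(u)} v‖₂ ≤ 4 ‖v‖₂`. [folklore] -/
theorem eucNorm_pairOp_mulVec_le (b : Bond L) (u : Q8) (v : 𝒮 → ℂ) :
    eucNorm (ℙop b u *ᵥ v) ≤ 4 * eucNorm v :=
  (eucNorm_mulVec_le _ _).trans (mul_le_mul_of_nonneg_right (norm_pairOp_le L b u) (eucNorm_nonneg v))

/-- **Cross terms vanish on the link-averaged vector**: for `b ≠ b'`,
`Σ_k ⟨P_b^{(k_b)} (Q_bψ)_k, P_{b'}^{(k_{b'})} (Q_bψ)_k⟩ = 0` (sum over `k_b` first, `Σ_u P_b^{(u)} = 0`). -/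
theorem cross_vanish {b b' : Bond L} (hbb' : b ≠ b') (ψ : Index L Q8 → ℂ) :
    ∑ k : Bond L → Q8, star (ℙop b (k b) *ᵥ fun s => (𝔸vg b ψ) (s, k)) ⬝ᵥ
      (ℙop b' (k b') *ᵥ fun s => (𝔸vg b ψ) (s, k)) = 0 := by
  -- the averaged vector depends only on the configuration off `b`
  have hφ : ∀ (v : Q8) (k' : {j // j ≠ b} → Q8),
      (fun s => (𝔸vg b ψ) (s, (Equiv.funSplitAt b Q8).symm (v, k'))) =
        fun s => (1 / (Fintype.card Q8 : ℂ)) * ∑ u, ψ (s, (Equiv.funSplitAt b Q8).symm (u, k')) := by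
    intro v k'
    funext s
    simp only [update_symm]
  rw [Fintype.sum_equiv (Equiv.funSplitAt b Q8) _
    (fun q => star (ℙop b q.1 *ᵥ fun s => (1 / (Fintype.card Q8 : ℂ)) *
        ∑ u, ψ (s, (Equiv.funSplitAt b Q8).symm (u, q.2))) ⬝ᵥ
      (ℙop b' (q.2 ⟨b', hbb'.symm⟩) *ᵥ fun s => (1 / (Fintype.card Q8 : ℂ)) *
        ∑ u, ψ (s, (Equiv.funSplitAt b Q8).symm (u, q.2)))) ?_]
  · rw [Fintype.sum_prod_type, Finset.sum_comm]
    refine Finset.sum_eq_zero fun k' _ => ?_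
    dsimp only
    rw [← sum_dotProduct, ← star_sum, ← Matrix.sum_mulVec, sum_pairOp, Matrix.zero_mulVec, star_zero,
      zero_dotProduct]
  · intro k
    have hk : (Equiv.funSplitAt b Q8).symm (k b, (Equiv.funSplitAt b Q8 k).2) = k := by
      have : (k b, (Equiv.funSplitAt b Q8 k).2) = Equiv.funSplitAt b Q8 k := rfl
      rw [this, Equiv.symm_apply_apply]
    have h1 := hφ (k b) (Equiv.funSplitAt b Q8 k).2
    rw [hk] at h1
    rw [h1]
    rfl

/-! #### The `O(L²) + o(1)` bound on `‖Δ_d^g ψ‖²` -/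

/-- `w_b - z_{b,b} = P_b^{(k_b)} (ψ - Q_bψ)(·,k)`. [folklore] -/
theorem wv_sub_zv (ψ : Index L Q8 → ℂ) (b : Bond L) (k : Bond L → Q8) :
    𝕎v ψ b k - ℤv ψ b b k = ℙop b (k b) *ᵥ fun s => (ψ - 𝔸vg b ψ) (s, k) := by
  rw [← Matrix.mulVec_sub]
  rfl

omit [NeZero L] in
/-- Cauchy–Schwarz over the fibres: `Σ_k ‖f_k‖ ‖g_k‖ ≤ ‖f‖ ‖g‖`. [folklore] -/
theorem sum_norm_mul_le (f g : Index L Q8 → ℂ) :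
    ∑ k : Bond L → Q8, eucNorm (fun s => f (s, k)) * eucNorm (fun s => g (s, k)) ≤
      eucNorm f * eucNorm g := by
  refine (sum_mul_le_sqrt_mul_sqrt _ _ _).trans ?_
  rw [← eucNorm_sq_prod, ← eucNorm_sq_prod, Real.sqrt_sq (eucNorm_nonneg _),
    Real.sqrt_sq (eucNorm_nonneg _)]

/-- Diagonal terms: `Σ_k ‖w_b(k)‖² ≤ 16 ‖ψ‖²`. [folklore] -/
theorem diag_term_le (ψ : Index L Q8 → ℂ) (b : Bond L) :
    ∑ k : Bond L → Q8, (star (𝕎v ψ b k) ⬝ᵥ 𝕎v ψ b k).re ≤ 16 * eucNorm ψ ^ 2 := by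
  calc ∑ k : Bond L → Q8, (star (𝕎v ψ b k) ⬝ᵥ 𝕎v ψ b k).re
      = ∑ k : Bond L → Q8, eucNorm (𝕎v ψ b k) ^ 2 := by simp only [eucNorm_sq]
    _ ≤ ∑ k : Bond L → Q8, 16 * eucNorm (fun s => ψ (s, k)) ^ 2 := Finset.sum_le_sum fun k _ => by
        have h : eucNorm (𝕎v ψ b k) ≤ 4 * eucNorm (fun s => ψ (s, k)) :=
          eucNorm_pairOp_mulVec_le L b (k b) _
        have h0 := eucNorm_nonneg (𝕎v ψ b k)
        nlinarith [eucNorm_nonneg (fun s => ψ (s, k))]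
    _ = 16 * eucNorm ψ ^ 2 := by rw [← Finset.mul_sum, ← eucNorm_sq_prod]

/-- Off-diagonal terms: `Σ_k Re⟨w_b(k), w_{b'}(k)⟩ ≤ 48 θ ‖ψ‖²` for `b ≠ b'`. [folklore] -/
theorem cross_term_le (ψ : Index L Q8 → ℂ) {b b' : Bond L} (hbb' : b ≠ b') (θ : ℝ) (hθ0 : 0 ≤ θ)
    (hθ1 : θ ≤ 1) (hθ : eucNorm (ψ - 𝔸vg b ψ) ≤ θ * eucNorm ψ) :
    ∑ k : Bond L → Q8, (star (𝕎v ψ b k) ⬝ᵥ 𝕎v ψ b' k).re ≤ 48 * θ * eucNorm ψ ^ 2 := by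
  have hsplit : ∀ k, star (𝕎v ψ b k) ⬝ᵥ 𝕎v ψ b' k =
      star (𝕎v ψ b k - ℤv ψ b b k) ⬝ᵥ 𝕎v ψ b' k +
        star (ℤv ψ b b k) ⬝ᵥ (𝕎v ψ b' k - ℤv ψ b b' k) +
        star (ℤv ψ b b k) ⬝ᵥ ℤv ψ b b' k := by
    intro k
    rw [star_sub, sub_dotProduct, dotProduct_sub]
    ring
  have hvan : ∑ k : Bond L → Q8, star (ℤv ψ b b k) ⬝ᵥ ℤv ψ b b' k = 0 := cross_vanish L hbb' ψ
  have e0 := eucNorm_nonneg ψ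
  set d := eucNorm (ψ - 𝔸vg b ψ) with hd
  have hd0 : 0 ≤ d := eucNorm_nonneg _
  have hdθ : d ≤ θ * eucNorm ψ := hθ
  -- norms of the fibre pieces
  have hA : ∀ k, eucNorm (𝕎v ψ b k - ℤv ψ b b k) ≤ 4 * eucNorm (fun s => (ψ - 𝔸vg b ψ) (s, k)) := by
    intro k
    rw [wv_sub_zv]
    exact eucNorm_pairOp_mulVec_le L b (k b) _
  have hA' : ∀ k, eucNorm (𝕎v ψ b' k - ℤv ψ b b' k) ≤ 4 * eucNorm (fun s => (ψ - 𝔸vg b ψ) (s, k)) := by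
    intro k
    have : 𝕎v ψ b' k - ℤv ψ b b' k = ℙop b' (k b') *ᵥ fun s => (ψ - 𝔸vg b ψ) (s, k) := by
      rw [← Matrix.mulVec_sub]
      rfl
    rw [this]
    exact eucNorm_pairOp_mulVec_le L b' (k b') _
  have hW : ∀ k, eucNorm (𝕎v ψ b' k) ≤ 4 * eucNorm (fun s => ψ (s, k)) := fun k =>
    eucNorm_pairOp_mulVec_le L b' (k b') _
  have hZ : ∀ k, eucNorm (ℤv ψ b b k) ≤ 4 * eucNorm (fun s => (𝔸vg b ψ) (s, k)) := fun k =>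
    eucNorm_pairOp_mulVec_le L b (k b) _
  -- first piece
  have h1 : ∑ k : Bond L → Q8, (star (𝕎v ψ b k - ℤv ψ b b k) ⬝ᵥ 𝕎v ψ b' k).re ≤
      16 * (d * eucNorm ψ) := by
    calc _ ≤ ∑ k : Bond L → Q8, (4 * eucNorm (fun s => (ψ - 𝔸vg b ψ) (s, k))) *
          (4 * eucNorm (fun s => ψ (s, k))) := Finset.sum_le_sum fun k _ => by
            refine (Complex.re_le_norm _).trans ((norm_star_dotProduct_le _ _).trans ?_)
            have hnn : 0 ≤ 4 * eucNorm (fun s => (ψ - 𝔸vg b ψ) (s, k)) := by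
              have := eucNorm_nonneg (fun s => (ψ - 𝔸vg b ψ) (s, k))
              linarith
            exact mul_le_mul (hA k) (hW k) (eucNorm_nonneg _) hnn
      _ = 16 * ∑ k : Bond L → Q8, eucNorm (fun s => (ψ - 𝔸vg b ψ) (s, k)) *
          eucNorm (fun s => ψ (s, k)) := by
            rw [Finset.mul_sum]
            refine Finset.sum_congr rfl fun k _ => ?_
            ring
      _ ≤ 16 * (d * eucNorm ψ) := by
            refine mul_le_mul_of_nonneg_left ?_ (by norm_num)
            exact sum_norm_mul_le L (ψ - 𝔸vg b ψ) ψ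
  -- second piece
  have hφn : eucNorm (𝔸vg b ψ) ≤ eucNorm ψ + d := by
    have h := eucNorm_sub_le ψ (ψ - 𝔸vg b ψ)
    rwa [sub_sub_cancel] at h
  have h2 : ∑ k : Bond L → Q8, (star (ℤv ψ b b k) ⬝ᵥ (𝕎v ψ b' k - ℤv ψ b b' k)).re ≤
      16 * ((eucNorm ψ + d) * d) := by
    calc _ ≤ ∑ k : Bond L → Q8, (4 * eucNorm (fun s => (𝔸vg b ψ) (s, k))) *
          (4 * eucNorm (fun s => (ψ - 𝔸vg b ψ) (s, k))) := Finset.sum_le_sum fun k _ => by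
            refine (Complex.re_le_norm _).trans ((norm_star_dotProduct_le _ _).trans ?_)
            have hnn : 0 ≤ 4 * eucNorm (fun s => (𝔸vg b ψ) (s, k)) := by
              have := eucNorm_nonneg (fun s => (𝔸vg b ψ) (s, k))
              linarith
            exact mul_le_mul (hZ k) (hA' k) (eucNorm_nonneg _) hnn
      _ = 16 * ∑ k : Bond L → Q8, eucNorm (fun s => (𝔸vg b ψ) (s, k)) *
          eucNorm (fun s => (ψ - 𝔸vg b ψ) (s, k)) := by
            rw [Finset.mul_sum]
            refine Finset.sum_congr rfl fun k _ => ?_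
            ring
      _ ≤ 16 * (eucNorm (𝔸vg b ψ) * d) := by
            refine mul_le_mul_of_nonneg_left ?_ (by norm_num)
            exact sum_norm_mul_le L (𝔸vg b ψ) (ψ - 𝔸vg b ψ)
      _ ≤ 16 * ((eucNorm ψ + d) * d) := by
            refine mul_le_mul_of_nonneg_left (mul_le_mul_of_nonneg_right hφn hd0) (by norm_num)
  -- assemble
  have hsum : ∑ k : Bond L → Q8, (star (𝕎v ψ b k) ⬝ᵥ 𝕎v ψ b' k).re =
      ∑ k : Bond L → Q8, (star (𝕎v ψ b k - ℤv ψ b b k) ⬝ᵥ 𝕎v ψ b' k).re +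
      ∑ k : Bond L → Q8, (star (ℤv ψ b b k) ⬝ᵥ (𝕎v ψ b' k - ℤv ψ b b' k)).re +
      (∑ k : Bond L → Q8, star (ℤv ψ b b k) ⬝ᵥ ℤv ψ b b' k).re := by
    rw [Complex.re_sum, ← Finset.sum_add_distrib, ← Finset.sum_add_distrib]
    refine Finset.sum_congr rfl fun k _ => ?_
    rw [hsplit k, Complex.add_re, Complex.add_re]
  rw [hsum, hvan, Complex.zero_re, add_zero]
  have hθ2 : θ * θ ≤ θ := by nlinarith
  have e2 : 0 ≤ eucNorm ψ ^ 2 := by positivity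
  nlinarith [h1, h2, hdθ, mul_le_mul_of_nonneg_right hdθ hd0, mul_le_mul_of_nonneg_right hdθ e0,
    mul_le_mul_of_nonneg_right hθ2 e2]

/-- **The pair ceiling, functional form**: if every link of `ψ` is `θ`-close to its average then
`‖Δ_d^g ψ‖² ≤ (16 |Bond L| + 48 θ |Bond L|²) ‖ψ‖²`. -/
theorem pair_bound (ψ : Index L Q8 → ℂ) (θ : ℝ) (hθ0 : 0 ≤ θ) (hθ1 : θ ≤ 1)
    (hθ : ∀ b : Bond L, eucNorm (ψ - 𝔸vg b ψ) ≤ θ * eucNorm ψ) :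
    eucNorm (spinGaugedPairField L *ᵥ ψ) ^ 2 ≤
      (16 * Fintype.card (Bond L) + 48 * θ * (Fintype.card (Bond L) : ℝ) ^ 2) * eucNorm ψ ^ 2 := by
  have hfib : ∀ k : Bond L → Q8, (fun s => (spinGaugedPairField L *ᵥ ψ) (s, k)) = ∑ b, 𝕎v ψ b k := by
    intro k
    funext s
    simp only [pairField_mulVec, Matrix.sum_mulVec, Finset.sum_apply]
  have htot : eucNorm (spinGaugedPairField L *ᵥ ψ) ^ 2 =
      ∑ b, ∑ b', ∑ k : Bond L → Q8, (star (𝕎v ψ b k) ⬝ᵥ 𝕎v ψ b' k).re := by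
    rw [eucNorm_sq_prod]
    simp only [hfib, eucNorm_sq, star_sum, sum_dotProduct, dotProduct_sum, Complex.re_sum]
    -- now `∑ k, ∑ b', ∑ b`; reorder to `∑ b, ∑ b', ∑ k`
    rw [Finset.sum_comm]
    have hswap : ∀ b' : Bond L, ∑ k : Bond L → Q8, ∑ b : Bond L, (star (𝕎v ψ b k) ⬝ᵥ 𝕎v ψ b' k).re =
        ∑ b : Bond L, ∑ k : Bond L → Q8, (star (𝕎v ψ b k) ⬝ᵥ 𝕎v ψ b' k).re := fun b' => Finset.sum_comm
    simp only [hswap]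
    exact Finset.sum_comm
  rw [htot]
  have hX : ∀ b b', ∑ k : Bond L → Q8, (star (𝕎v ψ b k) ⬝ᵥ 𝕎v ψ b' k).re ≤
      (if b = b' then 16 * eucNorm ψ ^ 2 else 0) + 48 * θ * eucNorm ψ ^ 2 := by
    intro b b'
    have e2 : 0 ≤ eucNorm ψ ^ 2 := by positivity
    by_cases h : b = b'
    · subst h
      rw [if_pos rfl]
      have := diag_term_le L ψ b
      nlinarith
    · rw [if_neg h, zero_add]
      exact cross_term_le L ψ h θ hθ0 hθ1 (hθ b)
  calc ∑ b, ∑ b', ∑ k : Bond L → Q8, (star (𝕎v ψ b k) ⬝ᵥ 𝕎v ψ b' k).re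
      ≤ ∑ b : Bond L, ∑ b' : Bond L, ((if b = b' then 16 * eucNorm ψ ^ 2 else 0) + 48 * θ * eucNorm ψ ^ 2) :=
        Finset.sum_le_sum fun b _ => Finset.sum_le_sum fun b' _ => hX b b'
    _ = (16 * Fintype.card (Bond L) + 48 * θ * (Fintype.card (Bond L) : ℝ) ^ 2) * eucNorm ψ ^ 2 := by
        simp only [Finset.sum_add_distrib, Finset.sum_ite_eq, Finset.mem_univ, if_true, Finset.sum_const,
          Finset.card_univ, nsmul_eq_mul]
        ring

end Model

end ColourTheSpinSgAnchorOrderRefutation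

end Summit.HubbardSuperconductivity.HubbardSuperconductivity.Theorems
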